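import Summits.ValiantsHypothesis.ValiantsHypothesis.Theorems.BarrierLeverNPCorpusChainTyped
import Summits.ValiantsHypothesis.ValiantsHypothesis.Theorems.BarrierLeverNPCorpusChainBDGILPrelims
import Literature.Computability.AlgebraicComplexity.HomogeneousComponentsComplexity
import Literature.Computability.AlgebraicComplexity.KRSTSelection
import Literature.NumberTheory.Automorphic.ZariskiCones

/-!
# Route BarrierLever — the NP corpus chain, part 3: the van den Berg–Dutta–Gesmundo–Ikenmeyer–Lysikov
# bridge typed against the crux (cell val-lit, NP corpus lead g5; source [BergEtAl2024] Def. 2.3 /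
# Thm. 2.4, typed by t19 in `Literature/Barriers/ValiantsHypothesis/BDGIL24IsotypicNaturalProofs.lean`)

Parts 1–2 recorded the arrows between the route's rung decls and the FSV / GKSS / KRST / CKRST
vocabularies. This file (part 3b; the field-level bookkeeping — dehomogenisation, affine input gates,
exponent arithmetic, re-indexing — is part 3a `BarrierLeverNPCorpusChainBDGILPrelims.lean`) adds ONE
further sorry-free arrow, from the representation-theoretic side:

* `hasAlgebraicNaturalProofs_of_not_crux` — if the crux
  `Theses.BarrierLever.SuccinctHittingSetsForVP` (stmt-ValiantsHypothesis-14610 = FSV Question 6 over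
  `ℂ`) FAILS, then the class `VP` cut out by the paper's invariant measure `cc` (t19's
  `BergEtAl2024.affComplexity`, proved invariant in `isInvariantMeasure_affComplexity`) HAS
  ALGEBRAIC NATURAL PROOFS in the sense of [BergEtAl2024] Def. 2.3
  (`BergEtAl2024.HasAlgebraicNaturalProofs`: a not-eventually-zero sequence of metapolynomials in
  `I(C) ∩ metaVQP`). Construction: along a diagonal of levels `n₀ < n₁ < …` on which level-`a`
  equations against `SmallCircuits ℂ n_k (k + 2)` exist (the negation of the crux, part 2's
  `not_crux_iff_io_not_hitting`), take a nonzero HOMOGENEOUS COMPONENT of the FSV distinguisher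
  (it still kills `SmallCircuits ℂ n_k (k + 1)`, scalar gates costing one), and re-index its
  `binom(2n,n)` coefficient variables from "monomials of degree `≤ n` in `n` variables" to
  "monomials of degree `n` in `n + 1` variables" (format `(δ, n, n + 1)`); a form `f` of degree `n`
  in `n + 1` variables with `cc(f) ≤ r(n)` dehomogenises (`x₀ ↦ 1`) to a polynomial of degree `≤ n`
  and gate count `≤ r + (2r + 1) · 4(n + 1)` (affine input gates are paid for; a size-`s` fan-in-two
  circuit reads `≤ 2s + 1` variables, `card_vars_le_complexity`), i.e. into `SmallCircuits ℂ n b`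
  for a fixed `b` once `r` is p-bounded — which the diagonal eventually dominates.
* `exists_isotypic_equations_of_not_crux` — hence, GIVEN the printed **Thm. 2.4** of [BergEtAl2024]
  (the named fact `BergEtAl2024.thm_2_4`, unproved in the tree), `¬ crux` yields a not-eventually-zero
  ISOTYPIC sequence in `I(C_VP) ∩ metaVQP` (each `Δ_n` in a single `GL_{n+1}`-isotypic component);
* `crux_of_no_isotypic_equations` / `crux_of_not_hasAlgebraicNaturalProofs` — the contrapositives,
  ending in the route decl: "what would suffice" for the crux in the V3 (isotypic / highest-weight)
  language — NO isotypic quasi-polynomial equation sequence against the `cc`-slices of `VP`.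

Honest framing. The converse arrows are NOT claimed and do not follow formally: Def. 2.3 allows
quasi-polynomial distinguishers, arbitrary formats `k(n)` and asks vanishing only eventually for each
p-bounded `r`, whereas the crux fixes `poly(N)` distinguishers, the format `d = n`, and is an
"eventually for SOME exponent `b`" statement (cf. part 2: the a.e./i.o. gap). Every hypothesis named
here (`¬ crux`, Thm. 2.4 as a fact, the absence of isotypic equations) is OPEN in print and in the
tree; `VP ≠ VNP` is not touched. No `sorry`; no named facts; the only `def`s are the explicit
diagonal witness (`level`, `rawD`, `hdeg`, `homD`, `ddeg`, `delta`), the re-indexing `homIdx` and the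
dehomogenisation map `dehomArgs`.

References: [BergEtAl2024] §2.1 (cc), §2.5 Def. 2.3, Thm. 2.4 (arXiv:2411.03444, PDF p.7, p.10–12);
[ForbesShpilkaVolk2018] Question 6; [GrochowKumarSaksSaraf2017] §1.1.
-/

set_option linter.dupNamespace false

noncomputable section

namespace Summit.ValiantsHypothesis.ValiantsHypothesis.Theorems.BarrierLever.NPCorpusChainBDGIL

open MvPolynomial Literature.Barriers.ValiantsHypothesis Literature.Computability.AlgebraicComplexity
open Literature.Barriers.ValiantsHypothesis.BergEtAl2024
open Summit.ValiantsHypothesis.ValiantsHypothesis.Theorems.BarrierLever.NPCorpusChainBDGILPrelims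

/-! ### Dehomogenisation and re-indexing (the two concrete maps) -/

/-- The substitution `x₀ ↦ 1`, `x_{j+1} ↦ x_j`. [folklore] -/
def dehomArgs (n : ℕ) : Fin (n + 1) → MvPolynomial (Fin n) ℂ :=
  fun i => Fin.cases (1 : MvPolynomial (Fin n) ℂ) (fun j => X j) i

/-- `x₀ ↦ 1`. [folklore] -/
@[simp] theorem dehomArgs_zero (n : ℕ) : dehomArgs n 0 = 1 := rfl

/-- `x_{j+1} ↦ x_j`. [folklore] -/
@[simp] theorem dehomArgs_succ (n : ℕ) (j : Fin n) : dehomArgs n j.succ = X j := rfl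

/-! ### Re-indexing the coefficient variables: degree `≤ n` in `n` variables ↔ degree `n` in `n + 1` -/

/-- `m ↦ x₀^{n - |m|} x^m`: monomials of degree `≤ n` in `x₁..x_n` as monomials of degree `n` in
`x₀..x_n`. [folklore] -/
def homIdx (n : ℕ) (m : degLEMonomials n) : DegIdx (Fin (n + 1)) n :=
  ⟨Finsupp.cons (n - (m : Fin n →₀ ℕ).degree) m, by
    have hm : (m : Fin n →₀ ℕ).degree ≤ n := m.2
    rw [mem_degMonomials_iff, Literature.Barriers.Schanuel.degree_cons]
    omega⟩

/-- The re-indexing is injective (`Finsupp.cons` is). [folklore] -/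
theorem homIdx_injective (n : ℕ) : Function.Injective (homIdx n) := by
  intro m m' h
  have h' := congrArg Subtype.val h
  simp only [homIdx] at h'
  exact Subtype.ext (Finsupp.cons_injective2 h').2

section Diagonal

variable {a : ℕ}

/-- **The diagonal of levels.** From "for every `b`, level-`a` distinguishers fail to be hit by
`SmallCircuits ℂ n b` for infinitely many `n`" (= `¬ crux`, part 2's `not_crux_iff_io_not_hitting`)
choose `2 ≤ n₀ < n₁ < n₂ < …` with a failure against exponent `k + 2` at `n_k`.
[cite: BergEtAl2024, §2.5 (I(C): "for every polynomially bounded r(n) … eventually"), p.10–11] -/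
def level (hio : ∀ b n₀ : ℕ, ∃ n, n₀ ≤ n ∧
    ¬ IsSuccinctHittingSet (degLEMonomials n) (SmallCircuits ℂ n b) (Distinguishers ℂ n a)) : ℕ → ℕ
  | 0 => Classical.choose (hio 2 2)
  | k + 1 => Classical.choose (hio (k + 3) (level hio k + 1))

variable (hio : ∀ b n₀ : ℕ, ∃ n, n₀ ≤ n ∧
    ¬ IsSuccinctHittingSet (degLEMonomials n) (SmallCircuits ℂ n b) (Distinguishers ℂ n a))

/-- Defining property of the first level. -/
theorem level_zero_spec : 2 ≤ level hio 0 ∧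
    ¬ IsSuccinctHittingSet (degLEMonomials (level hio 0)) (SmallCircuits ℂ (level hio 0) 2)
      (Distinguishers ℂ (level hio 0) a) :=
  Classical.choose_spec (hio 2 2)

/-- Defining property of the successor levels. -/
theorem level_succ_spec (k : ℕ) : level hio k + 1 ≤ level hio (k + 1) ∧
    ¬ IsSuccinctHittingSet (degLEMonomials (level hio (k + 1)))
      (SmallCircuits ℂ (level hio (k + 1)) (k + 3)) (Distinguishers ℂ (level hio (k + 1)) a) :=
  Classical.choose_spec (hio (k + 3) (level hio k + 1))

/-- Each level carries a failure against exponent `k + 2`. [cite: BergEtAl2024, §2.5, p.10–11] -/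
theorem not_hitting_level (k : ℕ) :
    ¬ IsSuccinctHittingSet (degLEMonomials (level hio k)) (SmallCircuits ℂ (level hio k) (k + 2))
      (Distinguishers ℂ (level hio k) a) := by
  cases k with
  | zero => exact (level_zero_spec hio).2
  | succ k => exact (level_succ_spec hio k).2

/-- The levels increase strictly. [folklore] -/
theorem level_strictMono : StrictMono (level hio) :=
  strictMono_nat_of_lt_succ fun k => (level_succ_spec hio k).1

/-- `k + 2 ≤ n_k` (so the levels are `≥ 2` and unbounded). [folklore] -/
theorem le_level (k : ℕ) : k + 2 ≤ level hio k := by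
  induction k with
  | zero => exact (level_zero_spec hio).1
  | succ k ih => exact le_trans (by omega) (level_succ_spec hio k).1

/-- Levels are `≥ 2`. [folklore] -/
theorem two_le_of_mem {n : ℕ} (h : ∃ k, level hio k = n) : 2 ≤ n := by
  obtain ⟨k, rfl⟩ := h; exact le_trans (by omega) (le_level hio k)

/-- The failure carried by a level `n = n_k`, against exponent `k + 2` (`k` = the chosen index). -/
theorem not_hitting_of_mem {n : ℕ} (h : ∃ k, level hio k = n) :
    ¬ IsSuccinctHittingSet (degLEMonomials n) (SmallCircuits ℂ n (Classical.choose h + 2))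
      (Distinguishers ℂ n a) := by
  have := not_hitting_level hio (Classical.choose h)
  rwa [Classical.choose_spec h] at this

/-- Levels past `n_b` have index `≥ b`. [folklore] -/
theorem le_index_of_mem {n : ℕ} (h : ∃ k, level hio k = n) {b : ℕ} (hb : level hio b ≤ n) :
    b ≤ Classical.choose h := by
  have hk : level hio (Classical.choose h) = n := Classical.choose_spec h
  rw [← hk] at hb
  exact (level_strictMono hio).le_iff_le.1 hb

/-! ### The witness at a level: a homogeneous component of the FSV distinguisher -/

/-- The FSV distinguisher at a level (chosen). [cite: ForbesShpilkaVolk2018, Def. 1] -/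
def rawD {n : ℕ} (h : ∃ k, level hio k = n) : MvPolynomial (degLEMonomials n) ℂ :=
  Classical.choose (exists_eqn_of_not_hitting (not_hitting_of_mem hio h))

/-- Defining property of the chosen distinguisher: small, nonzero, vanishing on the simple class
against exponent `(index) + 2`. [cite: ForbesShpilkaVolk2018, Def. 1 and Thm. 4] -/
theorem rawD_spec {n : ℕ} (h : ∃ k, level hio k = n) :
    rawD hio h ∈ Distinguishers ℂ n a ∧ rawD hio h ≠ 0 ∧
      ∀ g ∈ SmallCircuits ℂ n (Classical.choose h + 2),
        eval (coeffVector (degLEMonomials n) g) (rawD hio h) = 0 :=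
  Classical.choose_spec (exists_eqn_of_not_hitting (not_hitting_of_mem hio h))

/-- The degree of the chosen nonzero homogeneous component. -/
def hdeg {n : ℕ} (h : ∃ k, level hio k = n) : ℕ :=
  Classical.choose (exists_homogeneousComponent_ne_zero (rawD_spec hio h).2.1)

/-- Defining property of the chosen component degree. -/
theorem hdeg_spec {n : ℕ} (h : ∃ k, level hio k = n) :
    hdeg hio h ≤ (rawD hio h).totalDegree ∧ homogeneousComponent (hdeg hio h) (rawD hio h) ≠ 0 :=
  Classical.choose_spec (exists_homogeneousComponent_ne_zero (rawD_spec hio h).2.1)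

/-- The homogeneous witness at a level. [cite: BergEtAl2024, §2.5 (metapolynomials are homogeneous), p.10] -/
def homD {n : ℕ} (h : ∃ k, level hio k = n) : MvPolynomial (degLEMonomials n) ℂ :=
  homogeneousComponent (hdeg hio h) (rawD hio h)

/-- The homogeneous witness is nonzero. -/
theorem homD_ne_zero {n : ℕ} (h : ∃ k, level hio k = n) : homD hio h ≠ 0 := (hdeg_spec hio h).2

/-- **The homogeneous component still kills the simple class one exponent down** (the class is a
cone up to one scalar gate; over the infinite field `ℂ` a polynomial vanishing on all scalar
multiples of a point has all homogeneous components vanishing there).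
[cite: BergEtAl2024, §2.5 proof of Thm. 2.4 ("each X_{n,i} is invariant under the action"), p.11] -/
theorem homD_vanishes {n : ℕ} (h : ∃ k, level hio k = n) {g : MvPolynomial (Fin n) ℂ}
    (hg : g ∈ SmallCircuits ℂ n (Classical.choose h + 1)) :
    eval (coeffVector (degLEMonomials n) g) (homD hio h) = 0 := by
  refine Literature.NumberTheory.Automorphic.eval_homogeneousComponent_eq_zero_of_forall_smul
    (fun c _ => ?_) _
  have hcg := (rawD_spec hio h).2.2 (c • g) (smul_mem_smallCircuits (two_le_of_mem hio h) c hg)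
  have hvec : coeffVector (degLEMonomials n) (c • g) = c • coeffVector (degLEMonomials n) g := by
    funext m'; simp [coeffVector_apply, smul_eq_mul]
  rwa [hvec] at hcg

/-- Gate count of the homogeneous witness: `≤ (N^a + 2)² N^a`, `N = binom(2n, n)`.
[cite: BurgisserClausenShokrollahi1997, Lemma (21.25)] -/
theorem complexity_homD_le {n : ℕ} (h : ∃ k, level hio k = n) :
    complexity (homD hio h) ≤ ((2 * n).choose n ^ a + 2) ^ 2 * (2 * n).choose n ^ a := by
  obtain ⟨hc, hd⟩ := (rawD_spec hio h).1
  calc complexity (homD hio h) ≤ (hdeg hio h + 2) ^ 2 * complexity (rawD hio h) :=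
        complexity_homogeneousComponent_le_sq_mul _ _
    _ ≤ ((2 * n).choose n ^ a + 2) ^ 2 * (2 * n).choose n ^ a := by
        gcongr
        · exact (hdeg_spec hio h).1.trans hd

/-! ### The sequence -/

open scoped Classical in
/-- **The witness sequence** `Δ = (Δ_n)` of format `(δ(n), n, n + 1)`: at an emitted level the
re-indexed homogeneous component of the FSV distinguisher, elsewhere `0`.
[cite: BergEtAl2024, Def. 2.3, p.11] -/
def delta (n : ℕ) : MvPolynomial (DegIdx (Fin (n + 1)) n) ℂ :=
  if h : ∃ k, level hio k = n then rename (homIdx n) (homD hio h) else 0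

/-- `Δ_n` at a level. -/
theorem delta_of_emitted {n : ℕ} (h : ∃ k, level hio k = n) :
    delta hio n = rename (homIdx n) (homD hio h) := by
  simp only [delta, dif_pos h]

/-- `Δ_n = 0` off the levels. -/
theorem delta_of_not_emitted {n : ℕ} (h : ¬ ∃ k, level hio k = n) : delta hio n = 0 := by
  simp only [delta, dif_neg h]

open scoped Classical in
/-- The degree function `δ(n)` of the sequence: the chosen component degree at emitted levels,
`0` elsewhere. [cite: BergEtAl2024, §2.5 (format (δ, n, k(n))), p.10] -/
def ddeg (n : ℕ) : ℕ := if h : ∃ k, level hio k = n then hdeg hio h else 0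

/-- `δ(n)` at a level. -/
theorem ddeg_of_emitted {n : ℕ} (h : ∃ k, level hio k = n) : ddeg hio n = hdeg hio h := by
  simp only [ddeg, dif_pos h]

/-- `δ(n) = 0` off the levels. -/
theorem ddeg_of_not_emitted {n : ℕ} (h : ¬ ∃ k, level hio k = n) : ddeg hio n = 0 := by
  simp only [ddeg, dif_neg h]

/-- **`Δ ∈ I(C)` for `C = VP` in the `cc` measure**: for every p-bounded `r`, past the level `n_b`
(with `b` absorbing the dehomogenisation overhead of `r`) every `Δ_n` vanishes on the slice
`X_{n, r(n)}` of forms of degree `n` in `n + 1` variables with `cc ≤ r(n)`.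
[cite: BergEtAl2024, §2.5 (definition of I(C)), p.10–11] -/
theorem delta_mem_vanishingIdealSeq :
    delta hio ∈ vanishingIdealSeq (fun _ _ f => affComplexity f) (fun n => n + 1) := by
  intro r hr
  obtain ⟨c, hc⟩ := hr
  refine ⟨level hio (c + 6), fun n hn f hf => ?_⟩
  obtain ⟨hfh, hfc⟩ := hf
  by_cases h : ∃ k, level hio k = n
  · have hidx : c + 6 ≤ Classical.choose h := le_index_of_mem hio h hn
    have h2 : 2 ≤ n := two_le_of_mem hio h
    have hg : aeval (dehomArgs n) f ∈ SmallCircuits ℂ n (Classical.choose h + 1) :=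
      smallCircuits_mono ℂ (by omega) (by omega)
        (dehom_mem_smallCircuits (dehomArgs_zero n) (dehomArgs_succ n) hfh hfc
          (overhead_le_pow c n (r n) h2 (hc n)))
    have key : (formCoeff n f) ∘ homIdx n =
        coeffVector (degLEMonomials n) (aeval (dehomArgs n) f) := by
      funext m'
      simp only [Function.comp_apply, formCoeff_apply, coeffVector_apply, homIdx]
      exact (coeff_dehom_of_isHomogeneous (dehomArgs_zero n) (dehomArgs_succ n) hfh _ m'.2).symm
    rw [delta_of_emitted hio h, eval_rename, key]
    exact homD_vanishes hio h hg
  · rw [delta_of_not_emitted hio h, map_zero]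

/-- **`Δ ∈ metaVQP`**: format `k(n) = n + 1`, homogeneous of degree `δ(n) ≤ N^a`, and
`cc(Δ_n) ≤ (N^a + 2)² N^a ≤ 2^{(log₂ N + 3a + 4)^{3a+4}}`, `N = binom(2n, n)`.
[cite: BergEtAl2024, §2.5 (metaVQP), p.10] -/
theorem delta_mem_metaVQP : delta hio ∈ metaVQP (fun n => n + 1) := by
  refine ⟨⟨1, fun n => by simp⟩, ddeg hio, fun n => ?_, ⟨a, fun n => ?_⟩,
    ⟨3 * a + 4, fun n => ?_⟩⟩
  · by_cases h : ∃ k, level hio k = n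
    · rw [delta_of_emitted hio h, ddeg_of_emitted hio h]
      exact (homogeneousComponent_isHomogeneous _ _).rename_isHomogeneous
    · rw [delta_of_not_emitted hio h, ddeg_of_not_emitted hio h]
      exact isHomogeneous_zero _ _ _
  · rw [numMonomials_succ]
    by_cases h : ∃ k, level hio k = n
    · rw [ddeg_of_emitted hio h]
      exact ((hdeg_spec hio h).1.trans (rawD_spec hio h).1.2).trans (Nat.le_add_right _ _)
    · rw [ddeg_of_not_emitted hio h]; exact Nat.zero_le _
  · dsimp only
    rw [numMonomials_succ]
    refine qp_bound a _ _ (Nat.succ_le_of_lt (Nat.choose_pos (by omega))) ?_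
    by_cases h : ∃ k, level hio k = n
    · rw [delta_of_emitted hio h]
      calc affComplexity (rename (homIdx n) (homD hio h))
          ≤ complexity (rename (homIdx n) (homD hio h)) := affComplexity_le_complexity _
        _ ≤ complexity (homD hio h) := complexity_rename_le_holds' _ _
        _ ≤ ((2 * n).choose n ^ a + 2) ^ 2 * (2 * n).choose n ^ a := complexity_homD_le hio h
    · rw [delta_of_not_emitted hio h]
      calc affComplexity (0 : MvPolynomial (DegIdx (Fin (n + 1)) n) ℂ)
          ≤ complexity (0 : MvPolynomial (DegIdx (Fin (n + 1)) n) ℂ) :=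
            affComplexity_le_complexity _
        _ = 0 := by rw [← C_0]; exact complexity_C_holds _
        _ ≤ _ := Nat.zero_le _

/-- **`Δ` is not eventually zero**: at every level `n_k ≥ k + 2` it is the injective re-indexing of
a nonzero homogeneous component. [cite: BergEtAl2024, Def. 2.3, p.11] -/
theorem delta_not_eventuallyZero : ¬ EventuallyZero (delta hio) := by
  rintro ⟨n₀, h⟩
  have hE : ∃ k, level hio k = level hio n₀ := ⟨n₀, rfl⟩
  have hz := h (level hio n₀) (le_trans (by omega) (le_level hio n₀))
  rw [delta_of_emitted hio hE] at hz
  exact homD_ne_zero hio hE (rename_injective _ (homIdx_injective _) (by simpa using hz))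

end Diagonal

/-! ### The arrows -/

/-- **Infinitely-often failures at one level ⟹ `VP` has algebraic natural proofs in the sense of
[BergEtAl2024] Def. 2.3** (class cut out by the invariant measure `cc` = `affComplexity`, format
`k(n) = n + 1`; the witness is the diagonal sequence `delta`). The converse is NOT claimed
(quasi-polynomial vs polynomial distinguishers, free format, a.e. vs i.o.).
[cite: BergEtAl2024, Def. 2.3, p.11; ForbesShpilkaVolk2018, Question 6] -/
theorem hasAlgebraicNaturalProofs_of_io_not_hitting {a : ℕ}
    (hio : ∀ b n₀ : ℕ, ∃ n, n₀ ≤ n ∧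
      ¬ IsSuccinctHittingSet (degLEMonomials n) (SmallCircuits ℂ n b) (Distinguishers ℂ n a)) :
    HasAlgebraicNaturalProofs (fun _ _ f => affComplexity f) :=
  ⟨fun n => n + 1, delta hio, delta_mem_vanishingIdealSeq hio, delta_mem_metaVQP hio,
    delta_not_eventuallyZero hio⟩

/-- **¬ crux ⟹ `VP` (in the `cc` measure) has algebraic natural proofs, Def. 2.3** (part 2's
`not_crux_iff_io_not_hitting` supplies the infinitely-often failures that seed the diagonal).
[cite: BergEtAl2024, Def. 2.3, p.11; ForbesShpilkaVolk2018, Question 6] -/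
theorem hasAlgebraicNaturalProofs_of_not_crux (h : ¬ Theses.BarrierLever.SuccinctHittingSetsForVP) :
    HasAlgebraicNaturalProofs (fun _ _ f => affComplexity f) := by
  obtain ⟨a, ha⟩ := NPCorpusChainTyped.not_crux_iff_io_not_hitting.1 h
  exact hasAlgebraicNaturalProofs_of_io_not_hitting ha

/-- **Contrapositive, unconditional: "`VP` (in the `cc` measure) has NO algebraic natural proofs in
the sense of Def. 2.3" suffices for the crux** (stmt-ValiantsHypothesis-14610).
[cite: BergEtAl2024, Def. 2.3, p.11; ForbesShpilkaVolk2018, Question 6] -/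
theorem crux_of_not_hasAlgebraicNaturalProofs
    (h : ¬ HasAlgebraicNaturalProofs (fun _ _ f => affComplexity f)) :
    Theses.BarrierLever.SuccinctHittingSetsForVP := by
  by_contra hc
  exact h (hasAlgebraicNaturalProofs_of_not_crux hc)

/-- **¬ crux ⟹ ISOTYPIC equations, given Thm. 2.4.** With the printed Theorem 2.4 of
[BergEtAl2024] (named fact `BergEtAl2024.thm_2_4`, applied to `cc`, which IS an invariant measure by
t19's `isInvariantMeasure_affComplexity`), the failure of the crux yields a not-eventually-zero
sequence of ISOTYPIC metapolynomials (each in one `GL_{n+1}`-isotypic component `hwSubrep χ`) in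
`I(C_VP) ∩ metaVQP`. [cite: BergEtAl2024, Thm. 2.4, p.11] -/
theorem exists_isotypic_equations_of_not_crux (h24 : thm_2_4)
    (h : ¬ Theses.BarrierLever.SuccinctHittingSetsForVP) :
    ∃ (kk : ℕ → ℕ) (Δ : (n : ℕ) → MvPolynomial (DegIdx (Fin (kk n)) n) ℂ),
      Δ ∈ vanishingIdealSeq (fun _ _ f => affComplexity f) kk ∧ Δ ∈ metaVQP kk ∧
        (∀ n, IsIsotypic (Δ n)) ∧ ¬ EventuallyZero Δ :=
  (h24 _ isInvariantMeasure_affComplexity).1 (hasAlgebraicNaturalProofs_of_not_crux h)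

/-- **What would suffice, in the V3 language (given Thm. 2.4): NO isotypic quasi-polynomial equation
sequence against the `cc`-slices of `VP` ⟹ the crux `SuccinctHittingSetsForVP`** (FSV Question 6
over `ℂ`, stmt-ValiantsHypothesis-14610). Honest framing: a sufficient condition, not an
equivalence; both the hypothesis and Thm. 2.4's typed statement are unproved in the tree.
[cite: BergEtAl2024, Thm. 2.4, p.11; ForbesShpilkaVolk2018, Question 6] -/
theorem crux_of_no_isotypic_equations (h24 : thm_2_4)
    (hno : ¬ ∃ (kk : ℕ → ℕ) (Δ : (n : ℕ) → MvPolynomial (DegIdx (Fin (kk n)) n) ℂ),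
      Δ ∈ vanishingIdealSeq (fun _ _ f => affComplexity f) kk ∧ Δ ∈ metaVQP kk ∧
        (∀ n, IsIsotypic (Δ n)) ∧ ¬ EventuallyZero Δ) :
    Theses.BarrierLever.SuccinctHittingSetsForVP := by
  by_contra hc
  exact hno (exists_isotypic_equations_of_not_crux h24 hc)

end Summit.ValiantsHypothesis.ValiantsHypothesis.Theorems.BarrierLever.NPCorpusChainBDGIL

end
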